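import Literature.AlgebraicGeometry.Frobenioids.EquivalencePreStepsFSMFF2008Assembly
import Literature.AlgebraicGeometry.Frobenioids.ModelFrobenioidWalkingArrow
import Literature.AlgebraicGeometry.Frobenioids.FSMFFType2008Broom
import Literature.AlgebraicGeometry.Frobenioids.FrobeniusTypePerfect
import HarnessLib

/-!
# Frobenioids I, Theorem 3.4 (ii) AS PRINTED: non-vacuity beyond all previously proved generalities —
# a non-perfect Frobenioid of standard type over the broom (FSMFF-2008, not FSMFF-2024)

Mochizuki, *The geometry of Frobenioids I: the general theory*, Kyushu J. Math. **62** (2008) 293–400,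
Thm. 3.4 (ii) p. 62 [cite: MochizukiFrdI2008, Thm. 3.4 (ii) p.62]; Thm. 5.2 (ii)(iii) pp. 100–101
[cite: MochizukiFrdI2008, Thm. 5.2 (ii) p.101]; §0 "FSMFF-type" p. 17 and its 2024 revision
[cite: MochizukiFrdIComments2024, (28) p.3].

PROOF-ONLY file (seat abc-iut-L1-t11; no definitions). Before `EquivalencePreStepsFSMFF2008.lean` /
`EquivalencePreStepsFSMFF2008Assembly.lean` the tree proved [FrdI] Thm. 3.4 (ii) over bases of FSM-type, over
bases of FSMFF-type in the REVISED (2024) sense, and for Frobenioids of PERFECT type over printed bases. This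
file exhibits a Frobenioid in NONE of these classes to which the printed (2008) theorem now applies: the model
Frobenioid (Thm. 5.2; seat abc-iut-w4-d088's `ConstNatModel`, constant divisor monoid `(ℕ, +)`, zero
rational-function monoid) over seat abc-iut-w4-d093's BROOM (`FSMFFType2008Broom.lean`: of FSMFF-type as
printed, NOT of FSMFF-type in the revised sense — in particular not of FSM-type).
* §1 the broom is connected and totally epimorphic;
* §2 the model Frobenioid over it (a Frobenioid of standard type by seat abc-iut-w4-d088's generic Thm. 5.2
  instances) is NOT of group-like type and NOT of perfect
  type (its divisor monoids `ℕ` have no square roots; Prop. 1.10 (iii), `PreFrobenioid.isPerfect_divisorMonoid`);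
* §3 for every self-equivalence `Ψ` of it the three clauses of Thm. 3.4 (ii) hold with ALL antecedents of
  `FrdI.thm34ii_of_isOfFSMFFType` discharged (`thm34ii_conclusion_broom`), and the typed `PreFrobenioidData.Thm34ii`
  holds there (`thm34ii_ofFunctor_broom`);
* §4 `exists_frobenioid_fsmff2008_not_2024_not_perfect` — the existence statement.
No statement of the paper is strengthened; nothing here bears on [IUTchIII].
-/

noncomputable section

namespace Literature.AlgebraicGeometry.Frobenioids

open CategoryTheory Opposite

namespace Broom

/-! ### §1 The broom as a base category -/

/-- The broom is totally epimorphic (a thin category). [cite: MochizukiFrdI2008, §0 p.15] -/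
theorem isTotallyEpimorphic : IsTotallyEpimorphic (Lex ((Unit ⊕ Unit) ⊕ (Σ k : ℕ, Fin (k + 1)))) :=
  ⟨fun _ => ⟨fun _ _ _ => Subsingleton.elim _ _⟩⟩

/-- Every point of the broom is joined by a zigzag to the tooth point `(0, 0)`: a bottom point lies below it,
a tooth point lies above the bottom point `inl (inl ())`, which lies below `(0, 0)`. [cite: MochizukiFrdI2008, §0 p.16] -/
theorem zigzag_tooth_zero (x : Lex ((Unit ⊕ Unit) ⊕ (Σ k : ℕ, Fin (k + 1)))) :
    Zigzag x (toLex (Sum.inr ⟨0, 0⟩)) := by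
  induction x using Lex.rec with
  | h x =>
    rcases x with b | s
    · exact Zigzag.of_hom (homOfLE (Sum.Lex.inl_le_inr b _))
    · refine (Zigzag.of_inv (homOfLE (Sum.Lex.inl_le_inr (Sum.inl ()) s))).trans ?_
      exact Zigzag.of_hom (homOfLE (Sum.Lex.inl_le_inr (Sum.inl ()) _))

/-- The broom is connected. [cite: MochizukiFrdI2008, §0 p.16] -/
theorem isGraphConnected : IsGraphConnected (Lex ((Unit ⊕ Unit) ⊕ (Σ k : ℕ, Fin (k + 1)))) :=
  ⟨⟨toLex (Sum.inr ⟨0, 0⟩)⟩, fun x y => (zigzag_tooth_zero x).trans (zigzag_tooth_zero y).symm⟩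

/-- The broom is non-empty (the tooth point `(0, 0)`; part of "connected", FrdI §0 p. 16).
[cite: MochizukiFrdI2008, §0 p.16] -/
theorem nonempty : Nonempty (Lex ((Unit ⊕ Unit) ⊕ (Σ k : ℕ, Fin (k + 1)))) := ⟨toLex (Sum.inr ⟨0, 0⟩)⟩

end Broom

namespace ConstNatModel

/-! ### §2 The model Frobenioid of `(broom, ℕ, 0, Div_B)` -/

section BroomModel

variable (DivB : zeroMonoid.{0} (Lex ((Unit ⊕ Unit) ⊕ (Σ k : ℕ, Fin (k + 1)))) ⟶
  monoidGp ((Functor.const (Lex ((Unit ⊕ Unit) ⊕ (Σ k : ℕ, Fin (k + 1))))ᵒᵖ).obj (CommMonCat.of DegreeModel.N)))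

/-! Thm. 5.2 (ii)/(iii) for `(broom, ℕ, 0, Div_B)` are the INSTANCES `isFrobenioid DivB Broom.isGraphConnected
Broom.isTotallyEpimorphic` and `isOfStandardType DivB … Broom.isOfFSMFFType` of seat abc-iut-w4-d088's generic §1
(`ModelFrobenioidWalkingArrow.lean`); they are used inline below (no restatement). -/

/-- … and NOT of group-like type. [cite: MochizukiFrdI2008, Thm. 5.2 (iii) p.101] -/
theorem not_isOfGroupLikeType_broom : ¬ (ModelFrobenioid.data _ _ DivB).IsOfGroupLikeType :=
  haveI := Broom.nonempty
  not_isOfGroupLikeType DivB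

/-- The monoid `(ℕ, +)` is not perfect: `1` is not a double. [cite: MochizukiFrdI2008, §0 p.11] -/
theorem not_isPerfect_N : ¬ IsPerfect DegreeModel.N := fun h => by
  obtain ⟨x, hx⟩ := (h.bijective_pow 2 two_pos).2 (Multiplicative.ofAdd 1)
  have h2 := congrArg Multiplicative.toAdd hx
  simp only [toAdd_pow, toAdd_ofAdd, smul_eq_mul] at h2
  omega

/-- **The model Frobenioid over the broom is NOT of perfect type**: in a Frobenioid of perfect type every
divisor monoid is perfect (Prop. 1.10 (iii), `PreFrobenioid.isPerfect_divisorMonoid`), and `ℕ` is not.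
[cite: MochizukiFrdI2008, Prop. 1.10 (iii) p.35] -/
theorem not_isOfPerfectType_broom : ¬ PreFrobenioid.IsOfPerfectType (ModelFrobenioid.toElem _ _ DivB) := by
  intro hperf
  have hF := isFrobenioid DivB Broom.isGraphConnected Broom.isTotallyEpimorphic
  obtain ⟨A, -, -⟩ := hF.i_a (toLex (Sum.inr ⟨0, 0⟩))
  exact not_isPerfect_N (PreFrobenioid.isPerfect_divisorMonoid hF hperf A)

/-! ### §3 Thm. 3.4 (ii) AS PRINTED fires there -/

/-- **Non-vacuity of [FrdI] Thm. 3.4 (ii) AS PRINTED beyond the FSM-type / FSMFF-2024 / perfect-type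
generalities**: for the (non-perfect, standard-type) model Frobenioid over the broom (FSMFF-2008, not
FSMFF-2024) and every self-equivalence `Ψ`, the three clauses of Thm. 3.4 (ii) hold — all antecedents of
`FrdI.thm34ii_of_isOfFSMFFType` discharged. [cite: MochizukiFrdI2008, Thm. 3.4 (ii) p.62] -/
theorem thm34ii_conclusion_broom (Ψ : ModelFrobenioid _ _ DivB ≌ ModelFrobenioid _ _ DivB) :
    PreFrobenioidData.PreservesMor Ψ.functor (ModelFrobenioid.data _ _ DivB).IsPreStep
        (ModelFrobenioid.data _ _ DivB).IsPreStep ∧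
      PreFrobenioidData.PreservesMor Ψ.functor (ModelFrobenioid.data _ _ DivB).IsCoAngularPreStep
        (ModelFrobenioid.data _ _ DivB).IsCoAngularPreStep ∧
      PreFrobenioidData.PreservesObj Ψ.functor (ModelFrobenioid.data _ _ DivB).IsGroupLikeObj
        (ModelFrobenioid.data _ _ DivB).IsGroupLikeObj :=
  haveI := Broom.nonempty
  have hF := isFrobenioid DivB Broom.isGraphConnected Broom.isTotallyEpimorphic
  have hs := isOfStandardType DivB Broom.isGraphConnected Broom.isTotallyEpimorphic Broom.isOfFSMFFType
  FrdI.thm34ii_of_isOfFSMFFType hF hF hs.quasiIsotropic hs.quasiIsotropic Broom.isOfFSMFFType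
    Broom.isOfFSMFFType Ψ

/-- The typed `PreFrobenioidData.Thm34ii` at the broom model Frobenioid, for every self-equivalence.
[cite: MochizukiFrdI2008, Thm. 3.4 (ii) p.62] -/
theorem thm34ii_ofFunctor_broom (Ψ : ModelFrobenioid _ _ DivB ≌ ModelFrobenioid _ _ DivB) :
    (ModelFrobenioid.data _ _ DivB).Thm34ii (ModelFrobenioid.data _ _ DivB) Ψ :=
  FrdI.thm34ii_ofFunctor (isFrobenioid DivB Broom.isGraphConnected Broom.isTotallyEpimorphic)
    (isFrobenioid DivB Broom.isGraphConnected Broom.isTotallyEpimorphic) Ψ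

end BroomModel

/-! ### §4 The existence statement -/

/-- **A Frobenioid of standard type, NOT of perfect type, over a base of FSMFF-type AS PRINTED (2008) that is
NOT of FSMFF-type in the revised (2024) sense EXISTS** — so `FrdI.thm34ii_of_isOfFSMFFType` (with
`EquivalencePreStepsFSMFF2008.lean`) strictly extends the union of the FSM-type, FSMFF-2024 and perfect-type
versions of [FrdI] Thm. 3.4 (ii) at the level of Frobenioids. [cite: MochizukiFrdI2008, Thm. 5.2 (ii) p.101]
[cite: MochizukiFrdIComments2024, (28) p.3] -/
theorem exists_frobenioid_fsmff2008_not_2024_not_perfect :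
    ∃ (D : Type) (_ : Category.{0} D) (Φ : Dᵒᵖ ⥤ CommMonCat.{0}) (C : Type) (_ : Category.{0} C)
      (F : C ⥤ ElemFrobenioid Φ), PreFrobenioid.IsFrobenioid F ∧
        (PreFrobenioidData.ofFunctor Φ F).IsOfStandardType ∧ ¬ PreFrobenioid.IsOfPerfectType F ∧
        IsOfFSMFFType D ∧ ¬ IsOfFSMFFType2024 D := by
  let DivB : zeroMonoid.{0} (Lex ((Unit ⊕ Unit) ⊕ (Σ k : ℕ, Fin (k + 1)))) ⟶
      monoidGp ((Functor.const (Lex ((Unit ⊕ Unit) ⊕ (Σ k : ℕ, Fin (k + 1))))ᵒᵖ).obj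
        (CommMonCat.of DegreeModel.N)) :=
    { app := fun _ => CommMonCat.ofHom 1
      naturality := fun X Y f => by
        apply CommMonCat.hom_ext
        apply MonoidHom.ext
        intro x
        change (1 : (zeroMonoid.{0} _).obj Y →* _) ((zeroMonoid.{0} _).map f x) =
          ((monoidGp ((Functor.const (Lex ((Unit ⊕ Unit) ⊕ (Σ k : ℕ, Fin (k + 1))))ᵒᵖ).obj
            (CommMonCat.of DegreeModel.N))).map f).hom ((1 : (zeroMonoid.{0} _).obj X →* _) x)
        rw [MonoidHom.one_apply, MonoidHom.one_apply, map_one] }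
  exact ⟨_, inferInstance, _, ModelFrobenioid _ _ DivB, inferInstance, ModelFrobenioid.toElem _ _ DivB,
    isFrobenioid DivB Broom.isGraphConnected Broom.isTotallyEpimorphic,
    @isOfStandardType _ _ DivB Broom.nonempty Broom.isGraphConnected Broom.isTotallyEpimorphic Broom.isOfFSMFFType,
    not_isOfPerfectType_broom DivB, Broom.isOfFSMFFType, Broom.not_isOfFSMFFType2024⟩

end ConstNatModel

end Literature.AlgebraicGeometry.Frobenioids
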